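import Mathlib
import HarnessLib
import Literature.MathematicalPhysics.StatisticalMechanics.RootEnergy
import Literature.MathematicalPhysics.StatisticalMechanics.LennardJonesClusters
import Literature.MathematicalPhysics.StatisticalMechanics.MuGSC
import Summits.AtomisticToContinuum.Crystallization.Theorems.ChartedPlanarOrderRigidityDoor
import Summits.AtomisticToContinuum.Crystallization.Theorems.ChartedPlanarOrderChunkFloor
import Summits.AtomisticToContinuum.Crystallization.Theorems.ChartedPlanarOrderCrossBound

/-!
# `BindingSurface` holds: the root window of an `e⋆`-μ-ground state has excess site energy of SURFACE order

decomp-a2c · N `stmt-AtomisticToContinuum-26636` · the door input `ChartedPlanarOrderRigidityDoor.BindingSurface` (TRUE·M; critic rows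
381 (3) / 384 (2): «the LAST routine input on the critical path of N», K5′ `sparseMisfit_of_bulk : BULK → BindingSurface → WindowCounting →
SparseMisfit`).  PROVED:

  `bindingSurface_holds : BindingSurface` —
  `∀ δ > 0 ∃ C₁ ≥ 0 ∀ μ rooted δ-hard-core e⋆-μGSC ∀ R ≥ 1, Σᶠ_{x ∈ atomsIn μ 0 R} (e_x(μ) − e⋆) ≤ C₁ · R²`.

Proof (removal test `k = 0` + double counting + the cross bound): with `K` the atoms of the closed `R`-window (finite), enumerated
`xf : Fin n → ℝ³`, the `e⋆`-μGSC inequality with NO re-inserted atoms gives `U(K) + I(K, S∖K) ≤ n·e⋆`; the site energies of the window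
sum to `Σ_{x∈K} e_x = U(K) + ½ I(K, S∖K)` (`count|S = count|K + count|(S∖K)`, `two_mul_interactionEnergy_eq_sum_sum`); hence
`Σ_{x∈K}(e_x − e⋆) ≤ −½ I ≤ ½|I| ≤ ½ Σ_{x∈K} Σ'_{y∈S∖B̄(0,R)} |V| ≤ C₁(δ)·R²` by `ChartedPlanarOrderCrossBound.sum_tsum_abs_lj_cross_le`
(hand-1 g8, unit-shell decomposition).

Filed `--supports stmt-AtomisticToContinuum-26636` (helper, DEF-FREE; hand-1 g8 — cross bound and assembly; hand-2's cluster-exactness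
files prove the same removal-test bookkeeping in configuration currency).  Axioms standard.
-/

noncomputable section

namespace Summit.AtomisticToContinuum.Crystallization.Theorems.ChartedPlanarOrderBindingSurface

open MeasureTheory Metric Set
open Literature.MathematicalPhysics.StatisticalMechanics
open Literature.Probability.Process
open Summit.AtomisticToContinuum.Crystallization.Theorems.ChartedPlanarOrderRigidityDoor

/-- the site-energy integral against `count|S` of a separated `S` splits into the finite window part and the exterior series.
[folklore] -/
theorem integral_lj_eq_sum_add_tsum {δ : ℝ} (hδ : 0 < δ) {S : Set E3}
    (hsep : ∀ x ∈ S, ∀ y ∈ S, x ≠ y → δ ≤ dist x y) (Kf : Finset E3) (hKS : (↑Kf : Set E3) ⊆ S) (x : E3) :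
    ∫ y, lennardJones ‖y - x‖ ∂((Measure.count : Measure E3).restrict S) =
      (∑ y ∈ Kf, lennardJones (dist x y)) +
        ∑' y : ↥(S \ ↑Kf), lennardJones (dist x (y : E3)) := by
  classical
  have hsplit : (Measure.count : Measure E3).restrict S =
      (Measure.count : Measure E3).restrict (↑Kf : Set E3) + (Measure.count : Measure E3).restrict (S \ ↑Kf) := by
    rw [← Measure.restrict_union' disjoint_sdiff_right Kf.measurableSet, union_sdiff_cancel hKS]
  have hi1 : Integrable (fun y : E3 => lennardJones ‖y - x‖)
      ((Measure.count : Measure E3).restrict (↑Kf : Set E3)) :=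
    ChartedPlanarOrderChunkFloor.integrable_lj hδ hsep hKS x
  have hi2 : Integrable (fun y : E3 => lennardJones ‖y - x‖)
      ((Measure.count : Measure E3).restrict (S \ ↑Kf)) :=
    ChartedPlanarOrderChunkFloor.integrable_lj hδ hsep sdiff_subset x
  -- the exterior is countable (separated)
  have hcount : (S \ ↑Kf).Countable := by
    have hdisj : S.PairwiseDisjoint fun x => ball x (δ / 2) := by
      intro a ha b hb hab
      refine Set.disjoint_left.2 fun z hza hzb => ?_
      have h1 : dist z a < δ / 2 := mem_ball.1 hza
      have h2 : dist z b < δ / 2 := mem_ball.1 hzb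
      have h3 := hsep a ha b hb hab
      linarith [dist_triangle_left a b z]
    exact (hdisj.countable_of_isOpen (fun x _ => isOpen_ball) fun x _ => ⟨x, mem_ball_self (half_pos hδ)⟩).mono
      sdiff_subset
  rw [hsplit, integral_add_measure hi1 hi2, integral_count_restrict_coe_finset]
  have hnear : ∑ y ∈ Kf, lennardJones ‖y - x‖ = ∑ y ∈ Kf, lennardJones (dist x y) :=
    Finset.sum_congr rfl fun y _ => by rw [dist_comm, dist_eq_norm]
  have hfar : ∫ y, lennardJones ‖y - x‖ ∂((Measure.count : Measure E3).restrict (S \ ↑Kf)) =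
      ∑' y : ↥(S \ ↑Kf), lennardJones (dist x (y : E3)) := by
    have := setIntegral_countable (μ := (Measure.count : Measure E3)) (fun y : E3 => lennardJones ‖y - x‖) hcount hi2
    rw [this]
    refine tsum_congr fun y => ?_
    rw [measureReal_def, Measure.count_singleton, ENNReal.toReal_one, one_smul, dist_comm, dist_eq_norm]
  rw [hnear, hfar]

/-- **`BindingSurface` holds.** [this work] -/
theorem bindingSurface_holds : BindingSurface := by
  classical
  intro δ hδ
  obtain ⟨C₁, hC₁, hcross⟩ := ChartedPlanarOrderCrossBound.sum_tsum_abs_lj_cross_le hδ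
  refine ⟨C₁, hC₁, fun μ hμ hG R hR => ?_⟩
  obtain ⟨S, h0S, hsep, rfl⟩ := hμ
  have hsing : ∀ p : E3, (Measure.count : Measure E3).restrict S {p} ≠ 0 ↔ p ∈ S :=
    count_restrict_singleton_ne_zero_iff S
  have hatoms : {p : E3 | (Measure.count : Measure E3).restrict S {p} ≠ 0} = S := by
    ext p; exact hsing p
  -- the window and its enumeration
  have hKfin : (closedBall (0 : E3) R ∩ S).Finite :=
    LocalConfig.finite_inter_of_separated hδ hsep (isCompact_closedBall 0 R)
  set Kf : Finset E3 := hKfin.toFinset with hKf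
  have hmemKf : ∀ p : E3, p ∈ Kf ↔ p ∈ S ∧ ‖p‖ ≤ R := fun p => by
    rw [hKf, Set.Finite.mem_toFinset, mem_inter_iff, mem_closedBall_zero_iff, and_comm]
  have hKS : (↑Kf : Set E3) ⊆ S := fun p hp => ((hmemKf p).1 hp).1
  have hKsub : (↑Kf : Set E3) ⊆ S ∩ closedBall 0 R := fun p hp =>
    ⟨((hmemKf p).1 hp).1, mem_closedBall_zero_iff.2 ((hmemKf p).1 hp).2⟩
  have hwin : atomsIn ((Measure.count : Measure E3).restrict S) 0 R = ↑Kf := by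
    ext p
    rw [Finset.mem_coe, hmemKf]
    simp only [atomsIn, mem_setOf_eq, dist_zero_right]
    rw [hsing]
  have hdiff : S \ ↑Kf = S \ closedBall 0 R := by
    ext p
    simp only [mem_sdiff, Finset.mem_coe, hmemKf, mem_closedBall_zero_iff, not_and, not_le]
    constructor
    · rintro ⟨hpS, h⟩; exact ⟨hpS, h hpS⟩
    · rintro ⟨hpS, h⟩; exact ⟨hpS, fun _ => h⟩
  rw [hwin, finsum_mem_coe_finset]
  set n : ℕ := Kf.card with hn
  set xf : Fin n → E3 := fun i => ((Kf.equivFin.symm i : Kf) : E3) with hxf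
  have hinj : Function.Injective xf := fun i j hij => Kf.equivFin.symm.injective (Subtype.ext hij)
  have hrange : Set.range xf = ↑Kf := by
    ext p
    constructor
    · rintro ⟨i, rfl⟩; exact (Kf.equivFin.symm i).2
    · intro hp
      refine ⟨Kf.equivFin ⟨p, hp⟩, ?_⟩
      simp [hxf]
  have hsumKf : ∀ f : E3 → ℝ, ∑ x ∈ Kf, f x = ∑ i, f (xf i) := fun f => by
    rw [Fintype.sum_equiv Kf.equivFin.symm (fun i => f (xf i)) (fun x : Kf => f (x : E3)) (fun _ => rfl),
      Finset.sum_coe_sort Kf f]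
  -- the exterior series
  set T : Fin n → ℝ := fun i => ∑' y : ↥(S \ closedBall 0 R), lennardJones (dist (xf i) (y : E3)) with hT
  -- removal test with no re-inserted atoms: `U(K) + I ≤ n · e⋆`
  have hG' := hG
  unfold IsEStarGSC at hG'
  obtain ⟨-, hstab⟩ := hG'
  have hrem := hstab n xf hinj (by rw [hrange, hatoms]; exact hKS) 0 (fun i => Fin.elim0 i)
    (fun i => Fin.elim0 i) (by simp)
  rw [hatoms, hrange, hdiff] at hrem
  have hrem' : interactionEnergy lennardJones xf + ∑ i, T i ≤
      (⨅ Q : PeriodicConfiguration 3, Q.energyPerParticle lennardJones) * n := by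
    have h0 : interactionEnergy lennardJones (fun i : Fin 0 => (Fin.elim0 i : EuclideanSpace ℝ (Fin 3))) = 0 := by
      simp [interactionEnergy]
    simp only [Finset.univ_eq_empty, Finset.sum_empty, Nat.cast_zero, mul_zero, sub_zero, add_zero] at hrem
    rw [h0] at hrem
    linarith
  -- site energies of the window: `Σ e_x = U + ½ I`
  have hsite : ∀ i : Fin n, ChartedPlanarOrderRigidityDoor.siteEnergy ((Measure.count : Measure E3).restrict S) (xf i) =
      ((∑ k, lennardJones (dist (xf i) (xf k))) + T i) / 2 := by
    intro i
    unfold ChartedPlanarOrderRigidityDoor.siteEnergy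
    rw [integral_lj_eq_sum_add_tsum hδ hsep Kf hKS (xf i), hsumKf (fun y => lennardJones (dist (xf i) y))]
    congr 2
    rw [hdiff]
  have hU : ∑ i, ∑ k, lennardJones (dist (xf i) (xf k)) = 2 * interactionEnergy lennardJones xf :=
    (two_mul_interactionEnergy_eq_sum_sum lennardJones lennardJones_zero xf).symm
  have hsumsite : ∑ i, ChartedPlanarOrderRigidityDoor.siteEnergy ((Measure.count : Measure E3).restrict S) (xf i) =
      interactionEnergy lennardJones xf + (∑ i, T i) / 2 := by
    simp_rw [hsite]
    rw [← Finset.sum_div, Finset.sum_add_distrib, hU]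
    ring
  -- the cross bound controls `|I|`
  have hTud : UniformlyDiscrete (S \ closedBall (0 : E3) R) :=
    ⟨δ, hδ, fun a ha b hb hab => hsep a ha.1 b hb.1 hab⟩
  have habsT : ∀ i : Fin n, |T i| ≤ ∑' y : ↥(S \ closedBall 0 R), |lennardJones (dist (xf i) (y : E3))| := by
    intro i
    have hs : Summable fun y : ↥(S \ closedBall 0 R) => lennardJones (dist (xf i) (y : E3)) :=
      hTud.summable_lennardJones (xf i)
    have := norm_tsum_le_tsum_norm hs.norm
    simpa only [Real.norm_eq_abs] using this
  have hIabs : |∑ i, T i| ≤ C₁ * R ^ 2 := by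
    have h1 : |∑ i, T i| ≤ ∑ i, |T i| := Finset.abs_sum_le_sum_abs _ _
    have h2 : ∑ i, |T i| ≤ ∑ i, ∑' y : ↥(S \ closedBall 0 R), |lennardJones (dist (xf i) (y : E3))| :=
      Finset.sum_le_sum fun i _ => habsT i
    have h3 := hcross S hsep R hR Kf hKsub
    rw [hsumKf] at h3
    linarith
  -- assemble
  have hgoal : ∑ x ∈ Kf, (ChartedPlanarOrderRigidityDoor.siteEnergy ((Measure.count : Measure E3).restrict S) x - eStar) =
      (∑ i, ChartedPlanarOrderRigidityDoor.siteEnergy ((Measure.count : Measure E3).restrict S) (xf i)) - n * eStar := by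
    rw [Finset.sum_sub_distrib, hsumKf, Finset.sum_const, nsmul_eq_mul]
  rw [hgoal, hsumsite]
  have heStar : (⨅ Q : PeriodicConfiguration 3, Q.energyPerParticle lennardJones) = eStar := rfl
  rw [heStar] at hrem'
  have hR2 : 0 ≤ C₁ * R ^ 2 := by positivity
  have := neg_abs_le (∑ i, T i)
  linarith [abs_nonneg (∑ i, T i)]

end Summit.AtomisticToContinuum.Crystallization.Theorems.ChartedPlanarOrderBindingSurface

end
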